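import Mathlib
import Summits.Ventures.PercRepro2.A3CutSplit

/-!
# The cross-shield: the explored cut vertex `x` separates `{a₁, o}` from `{a₂, b}` — the fibres
(blind cell PercRepro2, night-1 g33; proofs/NIGHT1-G33.md §7; the sums and the identity are
A3CutCrossSums.lean)

Setting: `x` a cut vertex (`IsCut ends x ↑VA ↑VB EA EB`), the root `a₁` and the mark `o` on the `A`-side,
the root `a₂` and the mark `b` on the `B`-side (`b`, `a₂ ∈ VB ∪ {x}`).  A connection across the cut
passes through `x`, so on the cluster event `{C(x) = S ∪ T}` (`S ⊆ VA`, `x ∈ T ⊆ VB ∪ {x}`):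
`a₁ ↔ a₂` iff `a₁ ∈ S ∧ a₂ ∈ T` (`conn_cross_iff`) — the fibre of the `x`-exploration is the product of
the two side cluster events when `¬ (a₁ ∈ S ∧ a₂ ∈ T)` (`fibre_cross_eq`) and empty otherwise
(`fibre_cross_eq_empty`); `a₁ ↔ b` iff `a₁ ∈ S ∧ b ∈ T`, `a₂ ↔ o` iff `o ∈ S ∧ a₂ ∈ T`, while
`{a₂ ↔ b}` is a `B`-side and `{a₁ ↔ o}` an `A`-side event.  Hence every fibre mass is a product of an
`A`-factor (`alphaS`, `alphaO`) and a `B`-factor (`muT`, `muB`) with the root indicators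
(`mW_cross`, `Ssig_b_cross`, `Su_b_cross`, `Ssig_o_cross`, `Su_o_cross`, `s3_cross`).
Standard axioms.
-/

namespace Summit.Ventures.PercRepro2

open UnionCluster CovForm CutV

namespace CovForm

namespace A3Fibre

namespace CrossShield

/-! ## Connections across the cut on a cluster event -/

section Events

variable {V : Type*} {E : Type*} [DecidableEq V] {ends : E → Sym2 V} {x : V} {VA VB : Finset V}
  {EA EB : Set E} [DecidablePred (· ∈ EA)] [DecidablePred (· ∈ EB)]

omit [DecidablePred (· ∈ EB)] in
/-- On `{C(x) = S ∪ T}`, an `A`-vertex `y` is joined to `x` inside `A` iff `y ∈ S`. -/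
lemma connA_iff_mem (h : IsCut ends x ↑VA ↑VB EA EB) {y : V} (hy : y ∈ VA) {ω : Config E}
    {S : Finset V} (hS : S ⊆ VA) {T : Finset V} (hT : T ⊆ insert x VB) (hxT : x ∈ T)
    (hW : cluster ends ω x = ↑(S ∪ T)) : Conn ends (restrict EA ω) y x ↔ y ∈ S := by
  have key := clusterA_x_eq h hS hT hxT hW
  have hyx : y ≠ x := fun hc => h.x_notA (Finset.mem_coe.2 (hc ▸ hy))
  constructor
  · intro hc
    have : y ∈ cluster ends (restrict EA ω) x := conn_symm hc
    rw [key] at this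
    rcases Finset.mem_insert.1 (Finset.mem_coe.1 this) with hc' | hc'
    · exact absurd hc' hyx
    · exact hc'
  · intro hyS
    have : y ∈ cluster ends (restrict EA ω) x := by
      rw [key]; exact Finset.mem_coe.2 (Finset.mem_insert_of_mem hyS)
    exact conn_symm this

omit [DecidablePred (· ∈ EA)] in
/-- On `{C(x) = S ∪ T}`, `x` is joined to a `B`-vertex `z` (or `z = x`) inside `B` iff `z ∈ T`. -/
lemma connB_iff_mem (h : IsCut ends x ↑VA ↑VB EA EB) {z : V} (hz : z ∈ insert x VB) {ω : Config E}
    {S : Finset V} (hS : S ⊆ VA) {T : Finset V} (hT : T ⊆ insert x VB) (hxT : x ∈ T)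
    (hW : cluster ends ω x = ↑(S ∪ T)) : Conn ends (restrict EB ω) x z ↔ z ∈ T := by
  have key := clusterB_x_eq h hS hT hxT hW
  have _ := hz
  constructor
  · intro hc
    have : z ∈ cluster ends (restrict EB ω) x := hc
    rw [key] at this
    exact Finset.mem_coe.1 this
  · intro hzT
    have : z ∈ cluster ends (restrict EB ω) x := by rw [key]; exact Finset.mem_coe.2 hzT
    exact this

/-- **Connections across the cut on a cluster event**: for `y ∈ VA` and `z ∈ VB ∪ {x}`, on
`{C(x) = S ∪ T}`, `y ↔ z` iff `y ∈ S ∧ z ∈ T`. -/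
lemma conn_cross_iff (h : IsCut ends x ↑VA ↑VB EA EB) {y z : V} (hy : y ∈ VA)
    (hz : z ∈ insert x VB) {ω : Config E} {S : Finset V} (hS : S ⊆ VA) {T : Finset V}
    (hT : T ⊆ insert x VB) (hxT : x ∈ T) (hW : cluster ends ω x = ↑(S ∪ T)) :
    Conn ends ω y z ↔ y ∈ S ∧ z ∈ T := by
  rcases Finset.mem_insert.1 hz with rfl | hzB
  · rw [conn_iff_restrict h (Or.inl (Finset.mem_coe.2 hy)) (Or.inr rfl),
      connA_iff_mem h hy hS hT hxT hW]
    exact ⟨fun hyS => ⟨hyS, hxT⟩, fun hh => hh.1⟩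
  · rw [conn_across_iff h (Finset.mem_coe.2 hy) (Finset.mem_coe.2 hzB),
      connA_iff_mem h hy hS hT hxT hW, connB_iff_mem h hz hS hT hxT hW]

end Events

/-! ## The fibres -/

section Fibres

variable {V : Type*} {E : Type*} [DecidableEq V] {ends : E → Sym2 V} {x : V} {VA VB : Finset V}
  {EA EB : Set E} [DecidablePred (· ∈ EA)] [DecidablePred (· ∈ EB)] {a₁ a₂ o b : V}

/-- On an allowed pair the fibre is the cluster event, and it factors. -/
lemma fibre_cross_eq (h : IsCut ends x ↑VA ↑VB EA EB) (ha1 : a₁ ∈ VA) (ha2 : a₂ ∈ insert x VB)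
    {S : Finset V} (hS : S ⊆ VA) {T : Finset V} (hT : T ⊆ insert x VB) (hxT : x ∈ T)
    (hok : ¬ (a₁ ∈ S ∧ a₂ ∈ T)) :
    fibre ends a₁ a₂ x (S ∪ T) =
      sideEvent EA (clusterEvent ends x (↑(insert x S) : Set V)) ∩
        sideEvent EB (clusterEvent ends x (↑T : Set V)) := by
  rw [← clusterEvent_x_eq h hS hT hxT]
  unfold fibre
  refine Set.inter_eq_right.2 fun ω hW => ?_
  simp only [mem_avoidAll, Finset.mem_singleton, forall_eq]
  intro hc
  exact hok ((conn_cross_iff h ha1 ha2 hS hT hxT hW).1 (conn_symm hc))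

/-- On a forbidden pair (`a₁ ∈ S`, `a₂ ∈ T`) the fibre is empty. -/
lemma fibre_cross_eq_empty (h : IsCut ends x ↑VA ↑VB EA EB) (ha1 : a₁ ∈ VA)
    (ha2 : a₂ ∈ insert x VB) {S : Finset V} (hS : S ⊆ VA) {T : Finset V} (hT : T ⊆ insert x VB)
    (hxT : x ∈ T) (h1 : a₁ ∈ S) (h2 : a₂ ∈ T) : fibre ends a₁ a₂ x (S ∪ T) = ∅ := by
  ext ω
  simp only [fibre, Set.mem_inter_iff, mem_avoidAll, Finset.mem_singleton, forall_eq,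
    mem_clusterEvent, Set.mem_empty_iff_false, iff_false, not_and]
  intro hQ hW
  exact hQ (conn_symm ((conn_cross_iff h ha1 ha2 hS hT hxT hW).2 ⟨h1, h2⟩))

/-- `{a₁ ↔ z}`, `z ∈ VB ∪ {x}`, on a fibre: the whole fibre when `a₁ ∈ S ∧ z ∈ T`. -/
lemma fibre_cross_inter_a1_of (h : IsCut ends x ↑VA ↑VB EA EB) (ha1 : a₁ ∈ VA) {z : V}
    (hz : z ∈ insert x VB) {S : Finset V} (hS : S ⊆ VA) {T : Finset V} (hT : T ⊆ insert x VB)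
    (hxT : x ∈ T) (h1 : a₁ ∈ S) (hzT : z ∈ T) :
    fibre ends a₁ a₂ x (S ∪ T) ∩ connEvent ends a₁ z = fibre ends a₁ a₂ x (S ∪ T) := by
  refine Set.inter_eq_left.2 fun ω hω => ?_
  exact (conn_cross_iff h ha1 hz hS hT hxT hω.2).2 ⟨h1, hzT⟩

/-- `{a₁ ↔ z}`, `z ∈ VB ∪ {x}`, on a fibre: empty unless `a₁ ∈ S ∧ z ∈ T`. -/
lemma fibre_cross_inter_a1_of_not (h : IsCut ends x ↑VA ↑VB EA EB) (ha1 : a₁ ∈ VA) {z : V}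
    (hz : z ∈ insert x VB) {S : Finset V} (hS : S ⊆ VA) {T : Finset V} (hT : T ⊆ insert x VB)
    (hxT : x ∈ T) (hn : ¬ (a₁ ∈ S ∧ z ∈ T)) :
    fibre ends a₁ a₂ x (S ∪ T) ∩ connEvent ends a₁ z = ∅ := by
  ext ω
  simp only [Set.mem_inter_iff, mem_connEvent, Set.mem_empty_iff_false, iff_false, not_and]
  intro hω hc
  exact hn ((conn_cross_iff h ha1 hz hS hT hxT hω.2).1 hc)

/-- `{a₂ ↔ o}`, `o ∈ VA`, on a fibre: the whole fibre when `o ∈ S ∧ a₂ ∈ T`. -/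
lemma fibre_cross_inter_a2o_of (h : IsCut ends x ↑VA ↑VB EA EB) (ho : o ∈ VA)
    (ha2 : a₂ ∈ insert x VB) {S : Finset V} (hS : S ⊆ VA) {T : Finset V} (hT : T ⊆ insert x VB)
    (hxT : x ∈ T) (hoS : o ∈ S) (h2 : a₂ ∈ T) :
    fibre ends a₁ a₂ x (S ∪ T) ∩ connEvent ends a₂ o = fibre ends a₁ a₂ x (S ∪ T) := by
  refine Set.inter_eq_left.2 fun ω hω => ?_
  exact conn_symm ((conn_cross_iff h ho ha2 hS hT hxT hω.2).2 ⟨hoS, h2⟩)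

/-- `{a₂ ↔ o}`, `o ∈ VA`, on a fibre: empty unless `o ∈ S ∧ a₂ ∈ T`. -/
lemma fibre_cross_inter_a2o_of_not (h : IsCut ends x ↑VA ↑VB EA EB) (ho : o ∈ VA)
    (ha2 : a₂ ∈ insert x VB) {S : Finset V} (hS : S ⊆ VA) {T : Finset V} (hT : T ⊆ insert x VB)
    (hxT : x ∈ T) (hn : ¬ (o ∈ S ∧ a₂ ∈ T)) :
    fibre ends a₁ a₂ x (S ∪ T) ∩ connEvent ends a₂ o = ∅ := by
  ext ω
  simp only [Set.mem_inter_iff, mem_connEvent, Set.mem_empty_iff_false, iff_false, not_and]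
  intro hω hc
  exact hn ((conn_cross_iff h ho ha2 hS hT hxT hω.2).1 (conn_symm hc))

/-- `{a₂ ↔ z}`, `a₂, z ∈ VB ∪ {x}`, on an allowed fibre: joins the `B`-factor. -/
lemma fibre_cross_inter_a2z (h : IsCut ends x ↑VA ↑VB EA EB) (ha1 : a₁ ∈ VA)
    (ha2 : a₂ ∈ insert x VB) {z : V} (hz : z ∈ insert x VB) {S : Finset V} (hS : S ⊆ VA)
    {T : Finset V} (hT : T ⊆ insert x VB) (hxT : x ∈ T) (hok : ¬ (a₁ ∈ S ∧ a₂ ∈ T)) :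
    fibre ends a₁ a₂ x (S ∪ T) ∩ connEvent ends a₂ z =
      sideEvent EA (clusterEvent ends x (↑(insert x S) : Set V)) ∩
        sideEvent EB (clusterEvent ends x (↑T : Set V) ∩ connEvent ends a₂ z) := by
  rw [fibre_cross_eq h ha1 ha2 hS hT hxT hok]
  have e := connEvent_eq_sideEvent h.symm (mem_coe_union_of_mem_insert ha2)
    (mem_coe_union_of_mem_insert hz)
  conv_lhs => rw [e]
  rw [Set.inter_assoc, sideEvent_inter]

/-- `{a₁ ↔ o}`, `a₁, o ∈ VA`, on an allowed fibre: joins the `A`-factor. -/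
lemma fibre_cross_inter_a1o (h : IsCut ends x ↑VA ↑VB EA EB) (ha1 : a₁ ∈ VA) (ho : o ∈ VA)
    (ha2 : a₂ ∈ insert x VB) {S : Finset V} (hS : S ⊆ VA) {T : Finset V} (hT : T ⊆ insert x VB)
    (hxT : x ∈ T) (hok : ¬ (a₁ ∈ S ∧ a₂ ∈ T)) :
    fibre ends a₁ a₂ x (S ∪ T) ∩ connEvent ends a₁ o =
      sideEvent EA (clusterEvent ends x (↑(insert x S) : Set V) ∩ connEvent ends a₁ o) ∩
        sideEvent EB (clusterEvent ends x (↑T : Set V)) := by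
  rw [fibre_cross_eq h ha1 ha2 hS hT hxT hok]
  have e := connEvent_eq_sideEvent h (Or.inl (Finset.mem_coe.2 ha1)) (Or.inl (Finset.mem_coe.2 ho))
  conv_lhs => rw [e]
  rw [← sideEvent_inter]
  ext ω; simp only [Set.mem_inter_iff]; tauto

end Fibres

/-! ## The masses -/

section Masses

variable {V : Type*} {E : Type*} [DecidableEq V] [Fintype E] [DecidableEq E] {R : Type*} [CommRing R]

/-- The `A`-factor `α(S) = P_A(C_A(x) = insert x S)`. -/
noncomputable def alphaS (p : E → R) (ends : E → Sym2 V) (EA : Set E) [DecidablePred (· ∈ EA)]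
    (x : V) (S : Finset V) : R :=
  prob p (sideEvent EA (clusterEvent ends x (↑(insert x S) : Set V)))

/-- The `A`-factor with `o`: `α_o(S) = P_A(C_A(x) = insert x S, a₁ ↔ o)`. -/
noncomputable def alphaO (p : E → R) (ends : E → Sym2 V) (EA : Set E) [DecidablePred (· ∈ EA)]
    (x a₁ o : V) (S : Finset V) : R :=
  prob p (sideEvent EA (clusterEvent ends x (↑(insert x S) : Set V) ∩ connEvent ends a₁ o))

/-- The `B`-factor `μ(T) = P_B(C_B(x) = T)`. -/
noncomputable def muT (p : E → R) (ends : E → Sym2 V) (EB : Set E) [DecidablePred (· ∈ EB)]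
    (x : V) (T : Finset V) : R :=
  prob p (sideEvent EB (clusterEvent ends x (↑T : Set V)))

/-- The `B`-factor with `b`: `μ_b(T) = P_B(C_B(x) = T, a₂ ↔ b)`. -/
noncomputable def muB (p : E → R) (ends : E → Sym2 V) (EB : Set E) [DecidablePred (· ∈ EB)]
    (x a₂ b : V) (T : Finset V) : R :=
  prob p (sideEvent EB (clusterEvent ends x (↑T : Set V) ∩ connEvent ends a₂ b))

variable {ends : E → Sym2 V} {x : V} {VA VB : Finset V} {EA EB : Set E} [DecidablePred (· ∈ EA)]
  [DecidablePred (· ∈ EB)] {a₁ a₂ o b : V} {p : E → R}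

/-- `m_W` on an allowed pair. -/
lemma mW_cross (h : IsCut ends x ↑VA ↑VB EA EB) (ha1 : a₁ ∈ VA) (ha2 : a₂ ∈ insert x VB)
    {S : Finset V} (hS : S ⊆ VA) {T : Finset V} (hT : T ⊆ insert x VB) (hxT : x ∈ T)
    (hok : ¬ (a₁ ∈ S ∧ a₂ ∈ T)) :
    mW p ends a₁ a₂ x (S ∪ T) = alphaS p ends EA x S * muT p ends EB x T := by
  unfold mW alphaS muT
  rw [fibre_cross_eq h ha1 ha2 hS hT hxT hok]
  exact prob_sideEvent_inter_eq_mul p h _ _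

/-- The masses vanish on a forbidden pair. -/
lemma masses_cross_zero (h : IsCut ends x ↑VA ↑VB EA EB) (ha1 : a₁ ∈ VA) (ha2 : a₂ ∈ insert x VB)
    {S : Finset V} (hS : S ⊆ VA) {T : Finset V} (hT : T ⊆ insert x VB) (hxT : x ∈ T)
    (h1 : a₁ ∈ S) (h2 : a₂ ∈ T) (y : V) :
    mW p ends a₁ a₂ x (S ∪ T) = 0 ∧ Ssig p ends a₁ a₂ x y (S ∪ T) = 0 ∧
      Su p ends a₁ a₂ x y (S ∪ T) = 0 := by
  unfold mW Ssig Su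
  rw [fibre_cross_eq_empty h ha1 ha2 hS hT hxT h1 h2]
  simp

/-- `Ssig_b` on an allowed pair, `b ∈ VB ∪ {x}`. -/
lemma Ssig_b_cross (h : IsCut ends x ↑VA ↑VB EA EB) (ha1 : a₁ ∈ VA) (ha2 : a₂ ∈ insert x VB)
    (hb : b ∈ insert x VB) {S : Finset V} (hS : S ⊆ VA) {T : Finset V} (hT : T ⊆ insert x VB)
    (hxT : x ∈ T) (hok : ¬ (a₁ ∈ S ∧ a₂ ∈ T)) :
    Ssig p ends a₁ a₂ x b (S ∪ T) =
      ((if a₁ ∈ S ∧ b ∈ T then muT p ends EB x T else 0) - muB p ends EB x a₂ b T) *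
        alphaS p ends EA x S := by
  unfold Ssig muT muB alphaS
  rw [fibre_cross_inter_a2z h ha1 ha2 hb hS hT hxT hok, prob_sideEvent_inter_eq_mul p h]
  by_cases h1 : a₁ ∈ S ∧ b ∈ T
  · rw [if_pos h1, fibre_cross_inter_a1_of h ha1 hb hS hT hxT h1.1 h1.2,
      fibre_cross_eq h ha1 ha2 hS hT hxT hok, prob_sideEvent_inter_eq_mul p h]
    ring
  · rw [if_neg h1, fibre_cross_inter_a1_of_not h ha1 hb hS hT hxT h1, prob_empty]
    ring

/-- `Su_b` on an allowed pair, `b ∈ VB ∪ {x}`. -/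
lemma Su_b_cross (h : IsCut ends x ↑VA ↑VB EA EB) (ha1 : a₁ ∈ VA) (ha2 : a₂ ∈ insert x VB)
    (hb : b ∈ insert x VB) {S : Finset V} (hS : S ⊆ VA) {T : Finset V} (hT : T ⊆ insert x VB)
    (hxT : x ∈ T) (hok : ¬ (a₁ ∈ S ∧ a₂ ∈ T)) :
    Su p ends a₁ a₂ x b (S ∪ T) =
      ((if a₁ ∈ S ∧ b ∈ T then muT p ends EB x T else 0) + muB p ends EB x a₂ b T) *
        alphaS p ends EA x S := by
  unfold Su muT muB alphaS
  rw [fibre_cross_inter_a2z h ha1 ha2 hb hS hT hxT hok, prob_sideEvent_inter_eq_mul p h]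
  by_cases h1 : a₁ ∈ S ∧ b ∈ T
  · rw [if_pos h1, fibre_cross_inter_a1_of h ha1 hb hS hT hxT h1.1 h1.2,
      fibre_cross_eq h ha1 ha2 hS hT hxT hok, prob_sideEvent_inter_eq_mul p h]
    ring
  · rw [if_neg h1, fibre_cross_inter_a1_of_not h ha1 hb hS hT hxT h1, prob_empty]
    ring

/-- `Ssig_o` on an allowed pair, `o ∈ VA`. -/
lemma Ssig_o_cross (h : IsCut ends x ↑VA ↑VB EA EB) (ha1 : a₁ ∈ VA) (ho : o ∈ VA)
    (ha2 : a₂ ∈ insert x VB) {S : Finset V} (hS : S ⊆ VA) {T : Finset V} (hT : T ⊆ insert x VB)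
    (hxT : x ∈ T) (hok : ¬ (a₁ ∈ S ∧ a₂ ∈ T)) :
    Ssig p ends a₁ a₂ x o (S ∪ T) =
      (alphaO p ends EA x a₁ o S - (if o ∈ S ∧ a₂ ∈ T then alphaS p ends EA x S else 0)) *
        muT p ends EB x T := by
  unfold Ssig alphaO alphaS muT
  rw [fibre_cross_inter_a1o h ha1 ho ha2 hS hT hxT hok, prob_sideEvent_inter_eq_mul p h]
  by_cases h2 : o ∈ S ∧ a₂ ∈ T
  · rw [if_pos h2, fibre_cross_inter_a2o_of h ho ha2 hS hT hxT h2.1 h2.2,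
      fibre_cross_eq h ha1 ha2 hS hT hxT hok, prob_sideEvent_inter_eq_mul p h]
    ring
  · rw [if_neg h2, fibre_cross_inter_a2o_of_not h ho ha2 hS hT hxT h2, prob_empty]
    ring

/-- `Su_o` on an allowed pair, `o ∈ VA`. -/
lemma Su_o_cross (h : IsCut ends x ↑VA ↑VB EA EB) (ha1 : a₁ ∈ VA) (ho : o ∈ VA)
    (ha2 : a₂ ∈ insert x VB) {S : Finset V} (hS : S ⊆ VA) {T : Finset V} (hT : T ⊆ insert x VB)
    (hxT : x ∈ T) (hok : ¬ (a₁ ∈ S ∧ a₂ ∈ T)) :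
    Su p ends a₁ a₂ x o (S ∪ T) =
      (alphaO p ends EA x a₁ o S + (if o ∈ S ∧ a₂ ∈ T then alphaS p ends EA x S else 0)) *
        muT p ends EB x T := by
  unfold Su alphaO alphaS muT
  rw [fibre_cross_inter_a1o h ha1 ho ha2 hS hT hxT hok, prob_sideEvent_inter_eq_mul p h]
  by_cases h2 : o ∈ S ∧ a₂ ∈ T
  · rw [if_pos h2, fibre_cross_inter_a2o_of h ho ha2 hS hT hxT h2.1 h2.2,
      fibre_cross_eq h ha1 ha2 hS hT hxT hok, prob_sideEvent_inter_eq_mul p h]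
    ring
  · rw [if_neg h2, fibre_cross_inter_a2o_of_not h ho ha2 hS hT hxT h2, prob_empty]
    ring

omit [Fintype E] [DecidableEq E] [DecidablePred (· ∈ EA)] [DecidablePred (· ∈ EB)] in
/-- `s3` on a pair: `[a₁ ∈ S] − [a₂ ∈ T]` (on an allowed pair). -/
lemma s3_cross (h : IsCut ends x ↑VA ↑VB EA EB) (ha1 : a₁ ∈ VA) (ha2 : a₂ ∈ insert x VB)
    {S : Finset V} (hS : S ⊆ VA) {T : Finset V} (hT : T ⊆ insert x VB)
    (hok : ¬ (a₁ ∈ S ∧ a₂ ∈ T)) :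
    (s3 a₁ a₂ (S ∪ T) : R) = (if a₁ ∈ S then 1 else 0) - (if a₂ ∈ T then 1 else 0) := by
  have h1T : a₁ ∉ T := fun hc => notMem_VA_of_mem_VB h (hT hc) ha1
  have h2S : a₂ ∉ S := fun hc => notMem_VA_of_mem_VB h ha2 (hS hc)
  unfold s3
  simp only [Finset.mem_union, h1T, h2S, or_false, false_or]
  by_cases h1 : a₁ ∈ S
  · have h2 : a₂ ∉ T := fun hc => hok ⟨h1, hc⟩
    simp [h1, h2]
  · by_cases h2 : a₂ ∈ T
    · simp [h1, h2]
    · simp [h1, h2]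

end Masses

end CrossShield

end A3Fibre

end CovForm

end Summit.Ventures.PercRepro2
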